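import Summits.AtomisticToContinuum.Crystallization.Theorems.ReggeStarCoercivityDefectFreeCrystallizesLayeredGluing03

/-!
# Part 4 of the proof of `stub_layeredGluing : LayeredGluing` (S5a, line `prestress-split-korn`, crux stmt-AtomisticToContinuum-13603); see the module docstring of the final part `ReggeStarCoercivityDefectFreeCrystallizesLayeredGluing.lean` for the overview
-/

noncomputable section

open scoped BigOperators Classical InnerProductSpace
open Filter Topology

namespace Summit.AtomisticToContinuum.Crystallization.Theorems.PrestressSplitKorn

open Summit.AtomisticToContinuum.Crystallization.Theses
open Summit.AtomisticToContinuum.Crystallization.Theses.ReggeStarCoercivity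
open Summit.AtomisticToContinuum.Crystallization.Theorems.DefectFreeCrystallizes.Negative.PredicateAPI
open Literature.MathematicalPhysics.StatisticalMechanics Literature.Geometry.DiscreteGeometry


section Framed

variable {a : ℝ} {s : ℤ → ℤ} {z : ℤ → ℝ}
variable {Y : Set (EuclideanSpace ℝ (Fin 3))}

/-- The first-layer data read at any lattice point of the layer of `p` agree with those read at `p`. -/
theorem layer_data_const {p : EuclideanSpace ℝ (Fin 3)} (hL : LayerFramed a Y p) (hp : FramedAt a Y p s z) (i j : ℤ)
    {s' : ℤ → ℤ} {z' : ℤ → ℝ}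
    (hq : FramedAt a Y (p + ((i : ℝ) • triangularVec₁ a + (j : ℝ) • triangularVec₂ a)) s' z') :
    z' 1 = z 1 ∧ s' 0 = s 0 ∧ z' (-1) = z (-1) ∧ s' (-1) = s (-1) := by
  -- along `u`
  have hi : ∀ i : ℤ, ∀ {s' : ℤ → ℤ} {z' : ℤ → ℝ},
      FramedAt a Y (p + (i : ℝ) • triangularVec₁ a) s' z' →
        z' 1 = z 1 ∧ s' 0 = s 0 ∧ z' (-1) = z (-1) ∧ s' (-1) = s (-1) := by
    intro i
    induction i using Int.induction_on with
    | zero =>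
      intro s' z' hq
      have e : p + ((0 : ℤ) : ℝ) • triangularVec₁ a = p + 0 := by simp
      rw [e] at hq
      exact framed_data_eq (Or.inl rfl) hp hq
    | succ n ih =>
      intro s' z' hq
      obtain ⟨s'', z'', h''⟩ : ∃ (s'' : ℤ → ℤ) (z'' : ℤ → ℝ),
          FramedAt a Y (p + ((n : ℤ) : ℝ) • triangularVec₁ a) s'' z'' := by
        obtain ⟨s'', z'', h⟩ := hL n 0; exact ⟨s'', z'', by convert h using 2; simp⟩
      have h1 := ih h''
      have e : p + (((n : ℤ) + 1 : ℤ) : ℝ) • triangularVec₁ a =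
          p + ((n : ℤ) : ℝ) • triangularVec₁ a + triangularVec₁ a := by
        push_cast; module
      rw [e] at hq
      have h2 := framed_data_eq (Or.inr (Or.inl rfl)) h'' hq
      exact ⟨h2.1.trans h1.1, h2.2.1.trans h1.2.1, h2.2.2.1.trans h1.2.2.1, h2.2.2.2.trans h1.2.2.2⟩
    | pred n ih =>
      intro s' z' hq
      obtain ⟨s'', z'', h''⟩ : ∃ (s'' : ℤ → ℤ) (z'' : ℤ → ℝ),
          FramedAt a Y (p + ((-(n : ℤ) : ℤ) : ℝ) • triangularVec₁ a) s'' z'' := by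
        obtain ⟨s'', z'', h⟩ := hL (-(n : ℤ)) 0; exact ⟨s'', z'', by convert h using 2; simp⟩
      have h1 := ih h''
      have e : p + ((-(n : ℤ) : ℤ) : ℝ) • triangularVec₁ a =
          p + ((-(n : ℤ) - 1 : ℤ) : ℝ) • triangularVec₁ a + triangularVec₁ a := by
        push_cast; module
      rw [e] at h''
      have h2 := framed_data_eq (Or.inr (Or.inl rfl)) hq h''
      exact ⟨h2.1.symm.trans h1.1, h2.2.1.symm.trans h1.2.1, h2.2.2.1.symm.trans h1.2.2.1,
        h2.2.2.2.symm.trans h1.2.2.2⟩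
  -- along `v`, from the point `p + i u`
  obtain ⟨s₁, z₁, h₁⟩ : ∃ (s₁ : ℤ → ℤ) (z₁ : ℤ → ℝ),
      FramedAt a Y (p + ((i : ℤ) : ℝ) • triangularVec₁ a) s₁ z₁ := by
    obtain ⟨s'', z'', h⟩ := hL i 0; exact ⟨s'', z'', by convert h using 2; simp⟩
  have hd₁ := hi i h₁
  have hj : ∀ j : ℤ, ∀ {s' : ℤ → ℤ} {z' : ℤ → ℝ},
      FramedAt a Y (p + (i : ℝ) • triangularVec₁ a + (j : ℝ) • triangularVec₂ a) s' z' →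
        z' 1 = z₁ 1 ∧ s' 0 = s₁ 0 ∧ z' (-1) = z₁ (-1) ∧ s' (-1) = s₁ (-1) := by
    intro j
    induction j using Int.induction_on with
    | zero =>
      intro s' z' hq
      have e : p + (i : ℝ) • triangularVec₁ a + ((0 : ℤ) : ℝ) • triangularVec₂ a =
          p + (i : ℝ) • triangularVec₁ a + 0 := by simp
      rw [e] at hq
      exact framed_data_eq (Or.inl rfl) h₁ hq
    | succ n ih =>
      intro s' z' hq
      obtain ⟨s'', z'', h''⟩ : ∃ (s'' : ℤ → ℤ) (z'' : ℤ → ℝ),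
          FramedAt a Y (p + (i : ℝ) • triangularVec₁ a + ((n : ℤ) : ℝ) • triangularVec₂ a) s'' z'' := by
        obtain ⟨s'', z'', h⟩ := hL i n
        have e : p + (i : ℝ) • triangularVec₁ a + ((n : ℤ) : ℝ) • triangularVec₂ a =
            p + ((i : ℝ) • triangularVec₁ a + ((n : ℤ) : ℝ) • triangularVec₂ a) := by module
        exact ⟨s'', z'', by rw [e]; exact h⟩
      have h1 := ih h''
      have e : p + (i : ℝ) • triangularVec₁ a + (((n : ℤ) + 1 : ℤ) : ℝ) • triangularVec₂ a =
          p + (i : ℝ) • triangularVec₁ a + ((n : ℤ) : ℝ) • triangularVec₂ a + triangularVec₂ a := by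
        push_cast; module
      rw [e] at hq
      have h2 := framed_data_eq (Or.inr (Or.inr rfl)) h'' hq
      exact ⟨h2.1.trans h1.1, h2.2.1.trans h1.2.1, h2.2.2.1.trans h1.2.2.1, h2.2.2.2.trans h1.2.2.2⟩
    | pred n ih =>
      intro s' z' hq
      obtain ⟨s'', z'', h''⟩ : ∃ (s'' : ℤ → ℤ) (z'' : ℤ → ℝ),
          FramedAt a Y (p + (i : ℝ) • triangularVec₁ a + ((-(n : ℤ) : ℤ) : ℝ) • triangularVec₂ a) s'' z'' := by
        obtain ⟨s'', z'', h⟩ := hL i (-(n : ℤ))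
        have e : p + (i : ℝ) • triangularVec₁ a + ((-(n : ℤ) : ℤ) : ℝ) • triangularVec₂ a =
            p + ((i : ℝ) • triangularVec₁ a + ((-(n : ℤ) : ℤ) : ℝ) • triangularVec₂ a) := by module
        exact ⟨s'', z'', by rw [e]; exact h⟩
      have h1 := ih h''
      have e : p + (i : ℝ) • triangularVec₁ a + ((-(n : ℤ) : ℤ) : ℝ) • triangularVec₂ a =
          p + (i : ℝ) • triangularVec₁ a + ((-(n : ℤ) - 1 : ℤ) : ℝ) • triangularVec₂ a + triangularVec₂ a := by
        push_cast; module
      rw [e] at h''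
      have h2 := framed_data_eq (Or.inr (Or.inr rfl)) hq h''
      exact ⟨h2.1.symm.trans h1.1, h2.2.1.symm.trans h1.2.1, h2.2.2.1.symm.trans h1.2.2.1,
        h2.2.2.2.symm.trans h1.2.2.2⟩
  have e : p + ((i : ℝ) • triangularVec₁ a + (j : ℝ) • triangularVec₂ a) =
      p + (i : ℝ) • triangularVec₁ a + (j : ℝ) • triangularVec₂ a := by module
  rw [e] at hq
  have h2 := hj j hq
  exact ⟨h2.1.trans hd₁.1, h2.2.1.trans hd₁.2.1, h2.2.2.1.trans hd₁.2.2.1, h2.2.2.2.trans hd₁.2.2.2⟩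

/-- **Step 4b.** No point of `Y` lies strictly between the layer of `p` and the layer above it,
nor strictly between the layer below and the layer of `p`. -/
theorem no_between {p : EuclideanSpace ℝ (Fin 3)} (hL : LayerFramed a Y p) (hp : FramedAt a Y p s z) {y : EuclideanSpace ℝ (Fin 3)} (hy : y ∈ Y) :
    ¬ (p 2 < y 2 ∧ y 2 < p 2 + z 1) ∧ ¬ (p 2 + z (-1) < y 2 ∧ y 2 < p 2) := by
  have hbox := hp.1
  have hz0 := hp.2.2.1
  have ha := hbox.a_pos
  have ha1 := hbox.2.1
  have hz1 := hbox.z_one hz0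
  have hzm1 := hbox.z_neg_one hz0
  -- a lattice point of the layer of `p` within horizontal distance `2a/3` of `y`
  set d : EuclideanSpace ℝ (Fin 3) := y - p - (y 2 - p 2) • layerNormal 1 with hd
  have hd2 : d 2 = 0 := by simp [hd, layerNormal]
  obtain ⟨i, j, hij⟩ := exists_planar_near ha d hd2
  set q : EuclideanSpace ℝ (Fin 3) := p + ((i : ℝ) • triangularVec₁ a + (j : ℝ) • triangularVec₂ a) with hq
  obtain ⟨s', z', hq'⟩ := hL i j
  obtain ⟨e1, -, e3, -⟩ := layer_data_const hL hp i j hq'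
  have hq2 : q 2 = p 2 := by
    simp [hq, triangularVec₁, triangularVec₂]
  -- distance from `y` to `q`
  have hdist : ‖y - q‖ ^ 2 = ‖d - ((i : ℝ) • triangularVec₁ a + (j : ℝ) • triangularVec₂ a)‖ ^ 2 +
      (y 2 - p 2) ^ 2 := by
    rw [norm_sq_fin3, norm_sq_fin3]
    simp [hq, hd, layerNormal, triangularVec₁, triangularVec₂]
    ring
  have key : ∀ (hlt : |y 2 - p 2| < 17 / 20 * a), ∃ l : ℤ × ℤ × ℤ, y 2 - p 2 = z' l.1 := by
    intro hlt
    have hyq : dist y q < 2 := by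
      rw [dist_eq_norm]
      apply norm_lt_two_of_sq
      rw [hdist]
      have : (y 2 - p 2) ^ 2 < (17 / 20 * a) ^ 2 := by
        have := sq_lt_sq' (abs_lt.1 hlt).1 (abs_lt.1 hlt).2
        simpa using this
      nlinarith [hij]
    obtain ⟨l, hl⟩ := hq'.2.2.2.1 y hy hyq
    refine ⟨l, ?_⟩
    have := congrArg (fun x : EuclideanSpace ℝ (Fin 3) => x 2) hl
    simp only [PiLp.add_apply, PiLp.smul_apply, smul_eq_mul, layeredPos_apply_two] at this
    have hu : (triangularVec₁ a) 2 = 0 := by simp [triangularVec₁]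
    have hv : (triangularVec₂ a) 2 = 0 := by simp [triangularVec₂]
    rw [hu, hv] at this
    linarith
  constructor
  · rintro ⟨h1, h2⟩
    obtain ⟨l, hl⟩ := key (by rw [abs_lt]; constructor <;> linarith [hz1.2])
    have := (hq'.1.not_between hq'.2.2.1 l.1).1
    rw [← hl, e1] at this
    exact this ⟨by linarith, by linarith⟩
  · rintro ⟨h1, h2⟩
    obtain ⟨l, hl⟩ := key (by rw [abs_lt]; constructor <;> linarith [hzm1.2])
    have := (hq'.1.not_between hq'.2.2.1 l.1).2
    rw [← hl, e3] at this
    exact this ⟨by linarith, by linarith⟩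

/-- Auxiliary step `FramedAt.up_mem` of the proof of `stub_layeredGluing` (S5a); see the final part's module docstring. -/
theorem FramedAt.up_mem {p : EuclideanSpace ℝ (Fin 3)} (h : FramedAt a Y p s z) :
    p + ((s 0 : ℝ) • barlowOffset a + z 1 • layerNormal 1) ∈ Y := by
  have := h.2.2.2.2 (1, 0, 0) (by rw [layeredPos_one]; exact h.1.norm_up_lt h.2.2.1 h.2.1)
  rwa [layeredPos_one] at this

/-- Auxiliary step `FramedAt.down_mem` of the proof of `stub_layeredGluing` (S5a); see the final part's module docstring. -/
theorem FramedAt.down_mem {p : EuclideanSpace ℝ (Fin 3)} (h : FramedAt a Y p s z) :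
    p + ((-(s (-1)) : ℝ) • barlowOffset a + z (-1) • layerNormal 1) ∈ Y := by
  have := h.2.2.2.2 (-1, 0, 0) (by rw [layeredPos_neg_one]; exact h.1.norm_down_lt h.2.2.1 h.2.1)
  rwa [layeredPos_neg_one] at this

/-! ### Step 5: assembly of the global template -/

/-- Landing anchor of this file (registered stub of crux stmt-AtomisticToContinuum-13603; re-exports a result above). -/
theorem layeredGluing_part04_anchor :
    ∀ (a : ℝ) (Y : Set (EuclideanSpace ℝ (Fin 3))) (p : EuclideanSpace ℝ (Fin 3)) (s : ℤ → ℤ) (z : ℤ → ℝ), FramedAt a Y p s z → p + ((s 0 : ℝ) • barlowOffset a + z 1 • layerNormal 1) ∈ Y :=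
  fun _ _ _ _ _ h => h.up_mem

end Framed

end Summit.AtomisticToContinuum.Crystallization.Theorems.PrestressSplitKorn
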